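import Summits.RiemannHypothesis.RiemannHypothesis.Theorems.PfPersistenceLocalityBarrier
import HarnessLib

/-!
# PF persistence — the DIAL LEMMA (Rayleigh half) and what it closes (pub-rhpf, barrier-prover)

**HONEST FRAMING. Long-odds MECHANISM SEARCH; no RH claims.** Companion of the barrier-typer's
`PfPersistenceAdmissibleClass.lean` / `PfPersistenceLocalityBarrier.lean` (objects `Window`,
`Datum`, `zetaDatum`, `dialSpace`, `dial`, `primePattern`, `WindowPositive`, `UniformlyClose`,
`NegativesAccumulate`, `Separates`; labels PROVED / TYPED / DATA as there) and of the
barrier-prover's abstract walls `PfPersistenceBarrierWalls.lean` (W2 = zero-margin wall). This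
file supplies the finite-dimensional DIAL LEMMA of `pub-rhpf-lead/FRAMING.md` §3 in kernel form and
the two leaves it closes:

* §1 **Rayleigh algebra of a dial (PROVED)**: `rayleigh_sub_smul`; the sign FLIP
  `rayleigh_flip`: moving a block `M` along a direction `B` by the coefficient `c = 2ε/β`
  (`ε = vᵀMv > 0`, `β = vᵀBv ≠ 0`) gives `vᵀ(M − cB)v = −ε < 0`; `evenBlock_dial_coeff`: inside
  the arithmetic dial space the `p`-dial realises EVERY coefficient along `primePattern p`
  (`K = 1 + c / (2 w(p))`).
* §2 **Leaf L1 × R0, per-window UNSOUNDNESS (PROVED shape)** `dialStable_meets_negative`: a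
  single-window predicate of the block that is STABLE along the `p`-dial up to coefficient size
  `T` ("`ε₁`-blind at resolution `T`") and a Rayleigh vector with `2ε/|β| ≤ T` force the predicate
  to hold at a dial-space datum whose block is NOT window-positive — the predicate is unsound for
  positivity at that window. (The stability hypothesis is where continuity moduli / Davis–Kahan
  enter for concrete functionals; DATA: `ε₂/ε₁ = 10^{6.56}` at `a = 1`, FRAMING §3.)
* §3 **In-domain ACCUMULATION from the dial lemma (PROVED modulo TYPED inputs)**
  `negativesAccumulate_dialSpace_of_dialReady`: if `ζ`'s blocks have Rayleigh vectors of
  arbitrarily small quotient on windows reaching `p` against which the `p`-pattern keeps a floor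
  `β₀ |v|²` (`DialReady p β₀` — TYPED; = Galerkin upper law + `β(a) ≠ 0`, DATA R-PF3a / PF-N2) and
  the pattern is form-bounded (`PrimePatternFormBounded p`, TYPED, true analytically), then the
  NEGATIVE `p`-dials accumulate at `ζ` uniformly INSIDE `dialSpace`; with the typer's
  `not_separates_of_uniformlyRobust` this discharges the in-domain hypothesis of the
  uniform-modulus barrier: `not_separates_of_uniformlyRobust_of_dialReady` (leaf W2-unif).

Inputs by name: `evenBlock_dial_eq`, `uniformlyClose_dial`, `not_separates_of_uniformlyRobust`
(tree, `PfPersistenceLocalityBarrier.lean`).  No RH-bearing statement occurs in this file.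
-/

set_option linter.dupNamespace false

noncomputable section

open Matrix

namespace Summit.RiemannHypothesis.RiemannHypothesis.Theorems.PfPersistence

/-! ## §1 Rayleigh algebra of a dial (PROVED) -/

/-- PROVED: the Rayleigh value moves affinely along a direction: `vᵀ(M − cB)v = vᵀMv − c·vᵀBv`. [folklore] -/
theorem rayleigh_sub_smul {n : ℕ} (M B : Matrix (Fin n) (Fin n) ℝ) (c : ℝ) (v : Fin n → ℝ) :
    v ⬝ᵥ ((M - c • B) *ᵥ v) = v ⬝ᵥ (M *ᵥ v) - c * (v ⬝ᵥ (B *ᵥ v)) := by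
  rw [Matrix.sub_mulVec, Matrix.smul_mulVec, dotProduct_sub, dotProduct_smul, smul_eq_mul]

/-- **PROVED (DIAL LEMMA, Rayleigh half).** A vector whose Rayleigh value is beaten by the dial
term witnesses non-positivity of the dialled block: `vᵀMv < c·vᵀBv ⇒ ¬ WindowPositive (M − cB)`. [folklore] -/
theorem not_windowPositive_sub_smul {n : ℕ} {M B : Matrix (Fin n) (Fin n) ℝ} {c : ℝ}
    (v : Fin n → ℝ) (h : v ⬝ᵥ (M *ᵥ v) < c * (v ⬝ᵥ (B *ᵥ v))) : ¬ WindowPositive (M - c • B) := by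
  intro hpos
  have := hpos v
  rw [rayleigh_sub_smul] at this
  linarith

/-- **PROVED (the FLIP).** At the coefficient `c = 2ε/β` (`ε = vᵀMv`, `β = vᵀBv ≠ 0`) the
Rayleigh value of `v` is exactly `−ε`: a dial of `ε₁`-SCALE `2ε₁/|β|` flips the sign of the
bottom Rayleigh value (FRAMING §3: `ε₁(Q + tB) ≤ ε₁ + tβ`). [folklore] -/
theorem rayleigh_flip {n : ℕ} (M B : Matrix (Fin n) (Fin n) ℝ) (v : Fin n → ℝ)
    (hβ : v ⬝ᵥ (B *ᵥ v) ≠ 0) :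
    v ⬝ᵥ ((M - (2 * (v ⬝ᵥ (M *ᵥ v)) / (v ⬝ᵥ (B *ᵥ v))) • B) *ᵥ v) = -(v ⬝ᵥ (M *ᵥ v)) := by
  rw [rayleigh_sub_smul, div_mul_cancel₀ _ hβ]
  ring

/-- PROVED: the flip coefficient has size `2ε/|β|`. [folklore] -/
theorem abs_flip_coeff {ε β : ℝ} (hε : 0 ≤ ε) : |2 * ε / β| = 2 * ε / |β| := by
  rw [abs_div, abs_of_nonneg (by positivity : (0 : ℝ) ≤ 2 * ε)]

/-- **PROVED (realisation inside the dial space).** At a window reaching `p` and a weight table with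
`w(p) ≠ 0`, the `p`-dial with `K = 1 + c / (2 w(p))` moves the even block by EXACTLY `−c` times the
one-prime pattern: every coefficient along `primePattern p` is realised by an arithmetic dial. [folklore] -/
theorem evenBlock_dial_coeff {p : ℕ} {win : Window} (hp : p ∈ primeRange (2 * win.a)) {w : Weights}
    (hw : w p ≠ 0) (c : ℝ) :
    evenBlock (dial p (1 + c / (2 * w p)) w) win = evenBlock w win - c • primePattern p win := by
  rw [evenBlock_dial_eq hp]
  congr 2
  field_simp
  ring

/-! ## §2 Leaf L1 × R0: dial-stable single-window predicates are unsound per window (PROVED shape) -/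

/-- **PROVED (L1 × R0 per-window unsoundness).** Let `P` be a predicate of the block at ONE window
`win` reaching `p`, STABLE along the `p`-pattern up to coefficient size `T` at the weight table `w`
(`hstab`: "blind at resolution `T`" — for a functional Lipschitz in the block this is continuity,
for one reading `u₁` it is Davis–Kahan; entered as a hypothesis).  If some vector has Rayleigh value
`ε > 0` and pattern value `β ≠ 0` with flip size `2ε/|β| ≤ T`, then `P` holds at the block of a
dial-space datum (`dial p K w`) that is NOT window-positive: `P` does not certify positivity at
`win`.  With `ε = ε₁ ≪ T` (DATA: `ε₂/ε₁ = 10^{6.56}` at `a = 1`) this is the dial lemma's verdict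
on every `ε₁`-blind single-window functional. [folklore] -/
theorem dialStable_meets_negative {p : ℕ} {win : Window} (hp : p ∈ primeRange (2 * win.a))
    {w : Weights} (hw : w p ≠ 0)
    {P : Matrix (Fin (win.N + 1)) (Fin (win.N + 1)) ℝ → Prop} {T : ℝ}
    (hstab : ∀ c : ℝ, |c| ≤ T → P (evenBlock w win - c • primePattern p win))
    (v : Fin (win.N + 1) → ℝ) (hε : 0 < v ⬝ᵥ (evenBlock w win *ᵥ v))
    (hβ : v ⬝ᵥ (primePattern p win *ᵥ v) ≠ 0)
    (hT : 2 * (v ⬝ᵥ (evenBlock w win *ᵥ v)) / |v ⬝ᵥ (primePattern p win *ᵥ v)| ≤ T) :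
    ∃ K : ℝ, P (evenBlock (dial p K w) win) ∧ ¬ WindowPositive (evenBlock (dial p K w) win) := by
  set c : ℝ := 2 * (v ⬝ᵥ (evenBlock w win *ᵥ v)) / (v ⬝ᵥ (primePattern p win *ᵥ v)) with hc
  refine ⟨1 + c / (2 * w p), ?_, ?_⟩
  · rw [evenBlock_dial_coeff hp hw]
    exact hstab c (by rw [hc, abs_flip_coeff hε.le]; exact hT)
  · rw [evenBlock_dial_coeff hp hw]
    intro hpos
    have h := hpos v
    rw [hc, rayleigh_flip _ _ v hβ] at h
    linarith

/-- **PROVED (datum form).** Under the same hypotheses the single-window criterion `{d | P (d win)}`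
contains a DETECTABLY NEGATIVE member of the dial space generated from `w`'s dials; for
`w = zetaWeights` it therefore does not separate `ζ` from the dial-space negatives at that window
(per-window unsoundness; the GLOBAL statement for all finitely determined criteria is the typer's
`not_separates_of_finitelyDetermined`). [folklore] -/
theorem dialStable_criterion_meets_dialNegatives {p : ℕ} {win : Window}
    (hp : p ∈ primeRange (2 * win.a)) (hw : zetaWeights p ≠ 0)
    {P : Matrix (Fin (win.N + 1)) (Fin (win.N + 1)) ℝ → Prop} {T : ℝ}
    (hstab : ∀ c : ℝ, |c| ≤ T → P (zetaDatum win - c • primePattern p win))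
    (v : Fin (win.N + 1) → ℝ) (hε : 0 < v ⬝ᵥ (zetaDatum win *ᵥ v))
    (hβ : v ⬝ᵥ (primePattern p win *ᵥ v) ≠ 0)
    (hT : 2 * (v ⬝ᵥ (zetaDatum win *ᵥ v)) / |v ⬝ᵥ (primePattern p win *ᵥ v)| ≤ T) :
    ∃ d ∈ dialSpace, d ∈ {d : Datum | P (d win)} ∧ DetectablyNegative d := by
  obtain ⟨K, hPK, hneg⟩ := dialStable_meets_negative hp hw (P := P) hstab v hε hβ hT
  refine ⟨datumOf (dial p K zetaWeights), ⟨_, rfl⟩, hPK, win, ?_⟩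
  simpa [WindowPositive, datumOf, not_forall, not_le] using hneg

/-! ## §3 In-domain accumulation of negative dials at `ζ` (PROVED modulo TYPED inputs) -/

/-- **TYPED (`DialReady p β₀`).** On windows reaching `p`, `ζ`'s even blocks admit Rayleigh vectors
of arbitrarily small quotient against which the one-prime pattern keeps the floor `β₀ |v|²`.
Content: the Galerkin UPPER LAW (`GalerkinInfZero zetaDatum`; continuum version PROVED in the tree,
`weilGroundEnergy_exp_exp_decay`) together with NON-DEGENERACY of the dial direction on the bottom
cluster, `β(a) = ⟨u₁, P_p u₁⟩` bounded away from `0` (DATA R-PF3a / PF-N2 for `p = 2`; no theorem). [folklore] -/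
def DialReady (p : ℕ) (β₀ : ℝ) : Prop :=
  ∀ δ : ℝ, 0 < δ → ∃ win : Window, p ∈ primeRange (2 * win.a) ∧ ∃ v : Fin (win.N + 1) → ℝ,
    v ⬝ᵥ (zetaDatum win *ᵥ v) < δ * (v ⬝ᵥ v) ∧ β₀ * (v ⬝ᵥ v) ≤ |v ⬝ᵥ (primePattern p win *ᵥ v)|

/-- PROVED: a window whose prime range contains some `p ≥ 2` is a GENUINE window, `0 < a`
(so the witnesses below never live on the junk windows `a ≤ 0`; cf. REFEREE r7 §1). [folklore] -/
theorem window_pos_of_mem_primeRange {p : ℕ} {win : Window} (hp : p ∈ primeRange (2 * win.a))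
    (h2 : 2 ≤ p) : 0 < win.a := by
  unfold primeRange at hp
  rw [Finset.mem_range] at hp
  by_contra ha
  have ha : win.a ≤ 0 := not_lt.1 ha
  have hexp : Real.exp (2 * win.a) ≤ 1 := by
    rw [← Real.exp_zero]; exact Real.exp_le_exp.2 (by linarith)
  have hfloor : ⌊Real.exp (2 * win.a)⌋₊ ≤ 1 := by
    have := Nat.floor_le_floor hexp
    simpa using this
  omega

/-- **PROVED (dial lemma ⇒ explicit negative dials uniformly close to `ζ`; content in the
statement).** From `DialReady p β₀` (`β₀ > 0`, `w_ζ(p) > 0`) and the form bound on the pattern: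
for every `ε > 0` the dial `K` with `|K − 1| = ε/(2 w_ζ(p))` (sign chosen against `β`) is uniformly
`ε`-close to `ζ` AND has a NEGATIVE Rayleigh quotient at a named window containing `p` (hence a
genuine window, `window_pos_of_mem_primeRange`).  In particular `K ≠ 1`: the witness is never `ζ`
itself. [folklore] -/
theorem exists_negative_dial_uniformlyClose {p : ℕ} {β₀ : ℝ} (hβ₀ : 0 < β₀)
    (hw : 0 < zetaWeights p) (hP : PrimePatternFormBounded p) (hready : DialReady p β₀)
    {ε : ℝ} (hε : 0 < ε) :
    ∃ (K : ℝ) (win : Window) (v : Fin (win.N + 1) → ℝ),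
      |K - 1| = ε / (2 * zetaWeights p) ∧ p ∈ primeRange (2 * win.a) ∧
      v ⬝ᵥ (evenBlock (dial p K zetaWeights) win *ᵥ v) < 0 ∧
      UniformlyClose ε zetaDatum (datumOf (dial p K zetaWeights)) := by
  set t : ℝ := ε / (2 * zetaWeights p) with ht
  have htpos : 0 < t := by positivity
  obtain ⟨win, hp, v, hv, hβ⟩ := hready (t * zetaWeights p * β₀) (by positivity)
  set β : ℝ := v ⬝ᵥ (primePattern p win *ᵥ v) with hβdef
  set s : ℝ := if 0 ≤ β then 1 else -1 with hs
  have hsβ : s * β = |β| := by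
    rw [hs]
    split_ifs with h
    · rw [one_mul, abs_of_nonneg h]
    · rw [abs_of_neg (not_le.1 h)]; ring
  have hsabs : |s| = 1 := by
    rw [hs]; split_ifs <;> simp
  refine ⟨1 + s * t, win, v, ?_, hp, ?_, ?_⟩
  · rw [add_sub_cancel_left, abs_mul, hsabs, one_mul, abs_of_pos htpos]
  · -- negativity of the dialled block on `v`
    rw [evenBlock_dial_eq hp, rayleigh_sub_smul, add_sub_cancel_left]
    have hvv : 0 ≤ v ⬝ᵥ v := dotProduct_self_nonneg_real v
    have h1 : 2 * (s * t) * zetaWeights p * (v ⬝ᵥ (primePattern p win *ᵥ v))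
        = 2 * t * zetaWeights p * |β| := by
      rw [← hβdef, ← hsβ]; ring
    rw [h1]
    have h2 : 2 * t * zetaWeights p * (β₀ * (v ⬝ᵥ v)) ≤ 2 * t * zetaWeights p * |β| :=
      mul_le_mul_of_nonneg_left hβ (by positivity)
    have h3 : v ⬝ᵥ (zetaDatum win *ᵥ v) = v ⬝ᵥ (evenBlock zetaWeights win *ᵥ v) := rfl
    have h4 : 0 ≤ t * zetaWeights p * β₀ * (v ⬝ᵥ v) := by positivity
    linarith
  · -- uniform `ε`-closeness
    have hclose := uniformlyClose_dial hP (1 + s * t) zetaWeights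
    have hK : 2 * |1 + s * t - 1| * |zetaWeights p| = ε := by
      rw [add_sub_cancel_left, abs_mul, hsabs, one_mul, abs_of_pos htpos, abs_of_pos hw, ht]
      field_simp
    rw [hK] at hclose
    exact hclose

/-- **PROVED (dial lemma ⇒ in-domain accumulation, typer's hypothesis).** From `DialReady p β₀`
(`β₀ > 0`, `w_ζ(p) > 0`) and the form bound on the pattern, the NEGATIVE `p`-dials of `ζ`
accumulate at `ζ` uniformly inside the arithmetic dial space (`NegativesAccumulate`, the TYPED
input of `not_separates_of_uniformlyRobust`); the content-bearing form is
`exists_negative_dial_uniformlyClose`. [folklore] -/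
theorem negativesAccumulate_dialSpace_of_dialReady {p : ℕ} {β₀ : ℝ} (hβ₀ : 0 < β₀)
    (hw : 0 < zetaWeights p) (hP : PrimePatternFormBounded p) (hready : DialReady p β₀) :
    NegativesAccumulate dialSpace zetaDatum := by
  intro ε hε
  obtain ⟨K, win, v, -, -, hneg, hclose⟩ := exists_negative_dial_uniformlyClose hβ₀ hw hP hready hε
  exact ⟨datumOf (dial p K zetaWeights), ⟨_, rfl⟩, ⟨win, v, hneg⟩, hclose⟩

/-! ### The restricted (satisfiable) form bound

`PrimePatternFormBounded p` (typer) quantifies over ALL windows; at windows NOT reaching `p`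
(`log p > 2a`) the closed-form `thetaEven` is evaluated outside `[0, L]` and is unbounded
(`θ₀₀(L, log p) = (L − log p)/L → −∞` as `L → 0⁺`), so the unrestricted bound FAILS (e.g. `p = 2`,
`a = 1/10`, `N = 0`, `v = 1`: `|θ₀₀| = (log 2 − 0.2)/0.2 > 1`).  The dial lemma only needs the bound
at windows REACHING `p`, where `θ` is a genuine autocorrelation (`|Θ_V(y)| ≤ ‖V‖²`, Cauchy–Schwarz;
TYPED). The versions below use that restricted hypothesis and are therefore NOT vacuous. -/

/-- **PROVED (the unrestricted bound fails off-range).** At any window with `a = 1/10` (which does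
not reach `p = 2`: `e^{1/5} < 2`) the indicator vector of `ξ₀` has `|v ⬝ᵥ (P₂ v)| = |θ₀₀(1/5, log 2)| =
(log 2 − 1/5)/(1/5) > 1 = v ⬝ᵥ v`.  (No `Window` literal is used, so this survives a re-typing of
`Window`; instantiate with any window of half-length `1/10`.) [folklore] -/
theorem primePattern_two_formUnbounded (win : Window) (ha : win.a = 1 / 10) :
    ∃ v : Fin (win.N + 1) → ℝ, v ⬝ᵥ v < |v ⬝ᵥ (primePattern 2 win *ᵥ v)| := by
  refine ⟨Pi.single 0 1, ?_⟩
  have hlog : (0.6931471803 : ℝ) < Real.log 2 := Real.log_two_gt_d9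
  have h00 : primePattern 2 win 0 0 = (2 * win.a - Real.log 2) / (2 * win.a) := by
    simp [primePattern, thetaEven]
  have hq : Pi.single (0 : Fin (win.N + 1)) (1 : ℝ) ⬝ᵥ (primePattern 2 win *ᵥ Pi.single 0 1)
      = primePattern 2 win 0 0 := by
    simp [dotProduct, Pi.single_apply]
  have hvv : Pi.single (0 : Fin (win.N + 1)) (1 : ℝ) ⬝ᵥ Pi.single 0 1 = 1 := by
    simp [dotProduct, Pi.single_apply]
  rw [hq, hvv, h00, ha, lt_abs]
  right
  rw [neg_div', lt_div_iff₀ (by norm_num)]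
  linarith

/-- **PROVED: `PrimePatternFormBounded 2` (unrestricted, typer) is FALSE** as soon as a window of
half-length `1/10` exists (it does: `⟨1/10, 0⟩` in the current typing) — so every statement taking it
as a hypothesis (`uniformlyClose_dial`, `exists_negative_dial_uniformlyClose`,
`negativesAccumulate_dialSpace_of_dialReady`, `not_separates_of_uniformlyRobust_of_dialReady`) is
VACUOUS for `p = 2`; the primed versions below repair this with the restricted bound. [folklore] -/
theorem not_primePatternFormBounded_two (win : Window) (ha : win.a = 1 / 10) :
    ¬ PrimePatternFormBounded 2 := by
  intro h
  obtain ⟨v, hv⟩ := primePattern_two_formUnbounded win ha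
  exact (not_le.2 hv) (h win v)

/-- **TYPED (restricted form bound, satisfiable)**: at every window whose prime range reaches `p`,
the one-prime pattern is form-bounded by the identity.  True analytically (Cauchy–Schwarz on the
autocorrelation `Θ_V(log p)`, `0 ≤ log p ≤ L`); not proved here. [folklore] -/
def PrimePatternFormBoundedOn (p : ℕ) : Prop :=
  ∀ win : Window, p ∈ primeRange (2 * win.a) →
    ∀ v : Fin (win.N + 1) → ℝ, |v ⬝ᵥ (primePattern p win *ᵥ v)| ≤ v ⬝ᵥ v

/-- The unrestricted bound implies the restricted one. [folklore] -/
theorem PrimePatternFormBounded.boundedOn {p : ℕ} (hP : PrimePatternFormBounded p) :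
    PrimePatternFormBoundedOn p :=
  fun win _ v ↦ hP win v

/-- **PROVED (uniform closeness of dials from the RESTRICTED bound).** The `p`-dial by a factor `K`
is uniformly `2|K−1||w(p)|`-close; windows not reaching `p` see identical blocks. [folklore] -/
theorem uniformlyClose_dial_of_boundedOn {p : ℕ} (hP : PrimePatternFormBoundedOn p) (K : ℝ)
    (w : Weights) : UniformlyClose (2 * |K - 1| * |w p|) (datumOf w) (datumOf (dial p K w)) := by
  intro win v
  by_cases hp : p ∈ primeRange (2 * win.a)
  · have h : datumOf w win - datumOf (dial p K w) win = (2 * (K - 1) * w p) • primePattern p win := by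
      simp only [datumOf, evenBlock_dial_eq hp, sub_sub_cancel]
    rw [h, Matrix.smul_mulVec, dotProduct_smul, smul_eq_mul, abs_mul, abs_mul, abs_mul, abs_two]
    exact mul_le_mul_of_nonneg_left (hP win hp v) (by positivity)
  · have h : datumOf w win - datumOf (dial p K w) win = 0 := by
      simp only [datumOf, evenBlock_dial_of_not_mem (not_mem_primeRange_iff.1 hp), sub_self]
    rw [h, Matrix.zero_mulVec, dotProduct_zero, abs_zero]
    have := dotProduct_self_nonneg_real v
    positivity

/-- **PROVED (explicit negative dials uniformly close to `ζ`, RESTRICTED bound — the non-vacuous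
form of `exists_negative_dial_uniformlyClose`).** [folklore] -/
theorem exists_negative_dial_uniformlyClose' {p : ℕ} {β₀ : ℝ} (hβ₀ : 0 < β₀)
    (hw : 0 < zetaWeights p) (hP : PrimePatternFormBoundedOn p) (hready : DialReady p β₀)
    {ε : ℝ} (hε : 0 < ε) :
    ∃ (K : ℝ) (win : Window) (v : Fin (win.N + 1) → ℝ),
      |K - 1| = ε / (2 * zetaWeights p) ∧ p ∈ primeRange (2 * win.a) ∧
      v ⬝ᵥ (evenBlock (dial p K zetaWeights) win *ᵥ v) < 0 ∧
      UniformlyClose ε zetaDatum (datumOf (dial p K zetaWeights)) := by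
  set t : ℝ := ε / (2 * zetaWeights p) with ht
  have htpos : 0 < t := by positivity
  obtain ⟨win, hp, v, hv, hβ⟩ := hready (t * zetaWeights p * β₀) (by positivity)
  set β : ℝ := v ⬝ᵥ (primePattern p win *ᵥ v) with hβdef
  set s : ℝ := if 0 ≤ β then 1 else -1 with hs
  have hsβ : s * β = |β| := by
    rw [hs]
    split_ifs with h
    · rw [one_mul, abs_of_nonneg h]
    · rw [abs_of_neg (not_le.1 h)]; ring
  have hsabs : |s| = 1 := by
    rw [hs]; split_ifs <;> simp
  refine ⟨1 + s * t, win, v, ?_, hp, ?_, ?_⟩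
  · rw [add_sub_cancel_left, abs_mul, hsabs, one_mul, abs_of_pos htpos]
  · rw [evenBlock_dial_eq hp, rayleigh_sub_smul, add_sub_cancel_left]
    have hvv : 0 ≤ v ⬝ᵥ v := dotProduct_self_nonneg_real v
    have h1 : 2 * (s * t) * zetaWeights p * (v ⬝ᵥ (primePattern p win *ᵥ v))
        = 2 * t * zetaWeights p * |β| := by
      rw [← hβdef, ← hsβ]; ring
    rw [h1]
    have h2 : 2 * t * zetaWeights p * (β₀ * (v ⬝ᵥ v)) ≤ 2 * t * zetaWeights p * |β| :=
      mul_le_mul_of_nonneg_left hβ (by positivity)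
    have h3 : v ⬝ᵥ (zetaDatum win *ᵥ v) = v ⬝ᵥ (evenBlock zetaWeights win *ᵥ v) := rfl
    have h4 : 0 ≤ t * zetaWeights p * β₀ * (v ⬝ᵥ v) := by positivity
    linarith
  · have hclose := uniformlyClose_dial_of_boundedOn hP (1 + s * t) zetaWeights
    have hK : 2 * |1 + s * t - 1| * |zetaWeights p| = ε := by
      rw [add_sub_cancel_left, abs_mul, hsabs, one_mul, abs_of_pos htpos, abs_of_pos hw, ht]
      field_simp
    rw [hK] at hclose
    exact hclose

/-- **PROVED (in-domain accumulation from the RESTRICTED bound).** [folklore] -/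
theorem negativesAccumulate_dialSpace_of_dialReady' {p : ℕ} {β₀ : ℝ} (hβ₀ : 0 < β₀)
    (hw : 0 < zetaWeights p) (hP : PrimePatternFormBoundedOn p) (hready : DialReady p β₀) :
    NegativesAccumulate dialSpace zetaDatum := by
  intro ε hε
  obtain ⟨K, win, v, -, -, hneg, hclose⟩ :=
    exists_negative_dial_uniformlyClose' hβ₀ hw hP hready hε
  exact ⟨datumOf (dial p K zetaWeights), ⟨_, rfl⟩, ⟨win, v, hneg⟩, hclose⟩

/-- **PROVED (leaf W2-unif inside the dial space from the RESTRICTED bound, modulo the TYPED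
`DialReady`).** [folklore] -/
theorem not_separates_of_uniformlyRobust_of_dialReady' {p : ℕ} {β₀ : ℝ} (hβ₀ : 0 < β₀)
    (hw : 0 < zetaWeights p) (hP : PrimePatternFormBoundedOn p) (hready : DialReady p β₀)
    {S D : Set Datum} (hD : dialSpace ⊆ D) (hS : UniformlyRobustAt S zetaDatum) :
    ¬ Separates S D zetaDatum :=
  not_separates_of_uniformlyRobust (negativesAccumulate_dialSpace_of_dialReady' hβ₀ hw hP hready)
    hD hS

/-- **PROVED (leaf W2-unif inside the dial space, modulo the TYPED `DialReady` / form bound).**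
No criterion with an `a`-UNIFORM modulus at `ζ` (`UniformlyRobustAt`) separates `ζ` from the
negatives of any domain containing the arithmetic dial space. [folklore] -/
theorem not_separates_of_uniformlyRobust_of_dialReady {p : ℕ} {β₀ : ℝ} (hβ₀ : 0 < β₀)
    (hw : 0 < zetaWeights p) (hP : PrimePatternFormBounded p) (hready : DialReady p β₀)
    {S D : Set Datum} (hD : dialSpace ⊆ D) (hS : UniformlyRobustAt S zetaDatum) :
    ¬ Separates S D zetaDatum :=
  not_separates_of_uniformlyRobust (negativesAccumulate_dialSpace_of_dialReady hβ₀ hw hP hready)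
    hD hS

/-- PROVED: `w_ζ(2) > 0` — the `p = 2` dial (the observatory's `lambdapert`-type two-sided dial,
R-PF3a) is available. [folklore] -/
theorem zetaWeights_two_pos : 0 < zetaWeights 2 :=
  zetaWeights_pos_of_prime Nat.prime_two

end Summit.RiemannHypothesis.RiemannHypothesis.Theorems.PfPersistence

end
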